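import Summits.Ventures.CertifiedManyBodySolver.Observables.MeanFieldClassExclusionLaLowU
import Summits.Ventures.CertifiedManyBodySolver.Observables.PolarisedClassExclusionObjectE
import Summits.Ventures.CertifiedManyBodySolver.Certificates.HubbardSquare_n1_upper_pb2_U12_row470
import Literature.MathematicalPhysics.QuantumLattice.HubbardFermiSeaFourCornerRows
import Literature.MathematicalPhysics.QuantumLattice.HubbardFermiSeaFourCornerRowsHigh
import Literature.MathematicalPhysics.QuantumLattice.HubbardFermiSeaFourCornerRowsB
import Summits.Ventures.CertifiedManyBodySolver.Observables.PolarisedClassExclusionLaU10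
import HarnessLib

/-!
# Ventures/CertifiedManyBodySolver — Observables/ClassExclusionEdopedImages.lean

HONEST FRAMING: first certified bounds; not a superconductivity verdict; every number certified or labelled float.
A competing-order EXCLUSION removes a named class of candidate ground states; it never says which order is present;
no phase sentence follows.

Cell `hubbard-tc` (MO-S3, D-0096), seat `hubbard-tc-mod-3` (G3: competing orders as exclusion inputs from certified energy ORDERINGS),
`prover-hubbard-tc-mod-3-g5-0`. KERNEL G3 words for the ELECTRON-DOPED one-band columns of the S1 router — until now certified-numerics only,
because their object-E boxes sit at `|t′/t_eff| > 1/2`, outside the reach of every kernel Fermi-sea row (`HubbardFermiSeaCellRows` needs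
`|t′| ≤ 1/2`). The new general-`t′` rows of `HubbardFermiSeaFourCornerRows{,High}` (four-corner half-bathtub table of hubbard-tc-p1 + the
bathtub bridge) remove that restriction. As for every electron-doped row of the cell (router rule «PH image for S2», p1's `slcoBoxE…`,
TC-TABLE H-001 / V-014 / C-010 / C-011), the words are stated on the PARTICLE–HOLE IMAGE `(t′, n) ↦ (−t′, 2 − n)` of the box (Lieb–Wu:
`e(1, t′, U, n) = e(1, −t′, U, 2 − n) + U(n − 1)`, `energyDensityTT'_particleHole`; the double occupancy shifts by `n − 1`, `(n/2)²` by the same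
amount, quasi-free states go to quasi-free states and maximal-spin states to maximal-spin states, so both class words are PH-invariant):

* **Sr₀.₉La₀.₁CuO₂ (VSET M37, hold-out H-001; box `SrLaCuO2.md` object E `t′/t_eff ∈ [−0.649, −0.548]`, `n ∈ [1.09, 1.11]`, `U/t_eff ∈ [2.42, 11.24]`)**,
  image face `s ∈ [27/50, 13/20] ⊇ [0.548, 0.649]`, `m ∈ [0.89, 0.91]`:
  - `slcoE_x010_docc_lt_of` (MF/BCS class): EVERY `U ≥ 7.6`, `Re ω(n_{0↑}n_{0↓}) < (m/2)²` (cond. #472) — covers `[7.6, 11.24]` of the box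
    (the seat's cert-num engine printed `U ≥ 7.3` with the exact Fermi sea; the four-corner rows are `≈ 0.05·t` looser); exact margin `+0.0266`;
  - `slcoE_x010_lt_polarised_of` (saturated FM): EVERY `0 ≤ U ≤ 12` ⊇ the WHOLE box, `e(1, s, U, m) < ½·e(1, s, 0, 2m)` (cond. #470); margin `+0.032`.
* **Nd₁.₈₅Ce₀.₁₅CuO₄ (M20, V-014; object E `t′ ∈ [−0.62, −0.51]`, `n ∈ [1.09, 1.17]`, `U/t_eff ∈ [2.4, 3.2]`)**, image `s ∈ [51/100, 31/50]`, `m ∈ [0.83, 0.91]`: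
  `nccoE_x015_lt_polarised_of` — saturated FM excluded for EVERY `0 ≤ U ≤ 6` ⊇ WHOLE box (cond. #21); margin `+0.10`.
* **Nd₁.₉Ce₀.₁CuO₄ (M55, C-010; `t′ ∈ [−0.613, −0.499]`, `n ∈ [1.06, 1.12]`, `U/t_eff ∈ [2.41, 3.20]`)**, image `s ∈ [499/1000, 613/1000]`, `m ∈ [0.88, 0.94]`:
  `nccoE_x010_lt_polarised_of` — saturated FM excluded, EVERY `0 ≤ U ≤ 6` ⊇ WHOLE box (cond. #21); margin `+0.24`.
* **Nd₂CuO₄ T′ parent (M56, C-011; `t′ ∈ [−0.562, −0.461]`, `n ∈ [0.99, 1.01]`, `U/t_eff ∈ [2.17, 2.77]`)**: the hole half `n ∈ [0.99, 1)` directly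
  (`ncoE_parent_lt_polarised_of`, `t′ ∈ [−57/100, −23/50]`) and the electron half through its image (`ncoE_parent_image_lt_polarised_of`,
  `s ∈ [23/50, 57/100]`, `m ∈ [0.99, 1)`): saturated FM excluded for EVERY `0 ≤ U ≤ 16` (cond. #469); margins `+0.18 / +0.22`.
The MF/BCS class is NOT excludable on the Nd-family boxes (`U/t_eff ≤ 3.2`: the certified caps are far above `ℓ_free + U(n/2)²` there) — no word.

Devices (all tree theorems): caps = the half-filling caps #472 (`U = 8`), #470 (`U = 12`), #21 (`U = 6`), #469 (`U = 16`) — valid at every `t′`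
(`t′`-even + concave at `n = 1`) — read DOWN in density by the vacuum chord (`energyDensityTT'_le_vacuum_chord`, convexity in `n`, `e(0) ≤ 0`)
and down in `U` by monotonicity; floors = the four-corner tangent rows (`fermiSeaRow4_tPrime_*`) touching at `m₀ = 9/10` (MF word), `2m₀ = 9/5`
and `199/100` (FM words), read between columns by concavity in `t′` (`objE_floor_between`); tails = `doccN_lt_of_cap8_threshold` (MF; `(m/2)²`
above its tangent at `m = 0.89`, every leaf LINEAR) and `polar_word_of_cap` (FM). Exact designer: `hubbard-tc-mod-3/g5-replay/fc/design_edoped.py`.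
Conditional on the named claim nodes BY HYPOTHESIS. WHAT THIS IS NOT: a statement about AF order in the T′ cuprates, about the adequacy of the
one-band object, or about T_c; tight; a phase word.

References: E. H. Lieb, F. Y. Wu, Physica A 321 (2003) 1, §1 eq. (3) [LiebWuPhysicaA2003]; T. Koma, H. Tasaki, J. Stat. Phys. 76 (1994) 745, §1
[KomaTasaki1994]; V. Bach, E. H. Lieb, J. P. Solovej, J. Stat. Phys. 76 (1994) 3, eq. (2c.36) [BachLiebSolovej1994]; E. H. Lieb, M. Loss,
Duke Math. J. 71 (1993) 337, §8 Thm 8.2 [LiebLoss1993]; H. Tasaki, J. Phys.: Condens. Matter 10 (1998) 4353, §6 Thm 6.1 [Tasaki1998];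
D. Ruelle, Statistical Mechanics (1969) §3.3 [Ruelle1969].
-/

noncomputable section

namespace Summit.Ventures.CertifiedManyBodySolver.Observables

open Literature.MathematicalPhysics.QuantumLattice
open Literature.MathematicalPhysics.QuantumLattice.ThermodynamicLimit
open Summit.Ventures.CertifiedManyBodySolver.Certificates
open Matrix HubbardWave0 Literature.Probability.LatticeModels Filter Topology
open scoped ComplexOrder BigOperators

/-! ### §1 Devices -/

/-- **Vacuum chord at any `U_c ≥ 0`**: `e(1, s, U_c, 1) ≤ C` gives `e(1, s, U_c, n) ≤ n·C` for `0 < n < 1` (convexity in the density, `e(0) ≤ 0`).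
[cite: Ruelle1969, §3.3] -/
theorem edop_half_cap {s Uc n C : ℝ} (hUc : 0 ≤ Uc) (hC : energyDensityTT' 1 s Uc 1 ≤ C) (hn : 0 < n) (hn1 : n < 1) :
    energyDensityTT' 1 s Uc n ≤ n * C := by
  have hv := energyDensityTT'_le_vacuum_chord 1 s hUc hn hn1 (by norm_num) hC
  rw [div_one] at hv
  exact hv

/-- **Half-filling cap at `U = 12`, every `t′`**: `e(1, s, 12, 1) ≤ −0.3622300252` (CERTIFIED #470 at `t′ = 0`; `t′`-even + concave at half
filling). [cite: Israel1979, Thm. I.3.4] -/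
theorem edop_halfFilling_cap12 (h470 : cert_r470_pb2_tl_upper_n1_U12) (s : ℝ) :
    energyDensityTT' 1 s 12 1 ≤ -0.3622300252 := by
  have h := m2_U12_upper_r470_print h470
  have h0 : energyDensityTT' 1 0 12 1 ≤ -0.3622300252 := by
    rw [energyDensityTT'_zero]
    refine h.trans ?_
    push_cast
    norm_num
  exact (energyDensityTT'_one_le_tPrime_zero 1 s (by norm_num : (0 : ℝ) ≤ 12)).trans h0

/-! ### §2 Sr₀.₉La₀.₁CuO₂ — the MF/BCS class on the image face -/

/-- **Sr₀.₉La₀.₁CuO₂ (VSET M37), PH-image OBJECT-E face `s ∈ [27/50, 13/20]` × `m ∈ [0.89, 0.91]` — MF/BCS class excluded at EVERY `U ≥ 7.6`:**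
assume the claim node of CERTIFIED #472 (`cert_r472_pb2_tl_upper_n1_U8`); then every GS torus limit of `hubbardTorusTT' L 1 s U` at density `n ∈ [89/100, 91/100]`
has `Re ω(n_{0↑}n_{0↓}) < (n/2)²`. Cap at `U_c = 8` = vacuum chord of #472; floor = four-corner tangent rows at `n₀ = 9/10` (columns `27/50, 3/5, 13/20`);
two `s`-pieces; tail `doccN_lt_of_cap8_threshold` at `U₁ = 38/5`; smallest exact margin `+0.0266`.
[cite: KomaTasaki1994, §1] [cite: BachLiebSolovej1994, eq. (2c.36)] [cite: LiebLoss1993, §8, Theorem 8.2] -/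
theorem slcoE_x010_docc_lt_of (h472 : cert_r472_pb2_tl_upper_n1_U8)
    {s U n : ℝ} (hs1 : 27 / 50 ≤ s) (hs2 : s ≤ 13 / 20) (hU : 38 / 5 ≤ U)
    (hn1 : 89 / 100 ≤ n) (hn2 : n ≤ 91 / 100) :
    ∀ (ω : InfVolFermionState 2) (Ls : ℕ → ℕ) (ψ : ∀ L, Fock (Orb (FermionTorus 2 L))),
      Tendsto Ls atTop atTop →
      (∀ j, IsGroundStateInSector (hubbardTorusTT' (Ls j) 1 s U) (rectN n (Ls j)) 0 (ψ (Ls j))) →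
      (∀ j, star (ψ (Ls j)) ⬝ᵥ ψ (Ls j) = 1) → ω.IsTorusLimitOf ψ Ls →
      (ω.expect ({0} : Finset (Site 2))
        (nAt 0 (Finset.mem_singleton_self 0) 0 * nAt 0 (Finset.mem_singleton_self 0) 1)).re < (n / 2) ^ 2 := by
  have hn0 : (0 : ℝ) ≤ n := by linarith
  have hn2' : n < 2 := by linarith
  have hnpos : (0 : ℝ) < n := by linarith
  -- the class constant `(n/2)²` above its tangent at the lower band edge, scaled by the threshold
  have hsq : (-7921 / 40000 : ℝ) + 89 / 200 * n ≤ (n / 2) ^ 2 := by nlinarith [sq_nonneg (n - 89 / 100)]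
  have hsqU : ((-7921 / 40000 : ℝ) + 89 / 200 * n) * (38 / 5) ≤ (n / 2) ^ 2 * (38 / 5) :=
    mul_le_mul_of_nonneg_right hsq (by norm_num)
  have hcap := objE_half_cap8 (objE_halfFilling_cap8 h472 s) hnpos (by linarith)
  have ra := fermiSeaRow4_tPrime_twentyseven_div_fifty_at_nine_div_ten (U := 0) le_rfl hn0 hn2'
  have rb := fermiSeaRow4_tPrime_three_div_five_at_nine_div_ten (U := 0) le_rfl hn0 hn2'
  have rc := fermiSeaRow4_tPrime_thirteen_div_twenty_at_nine_div_ten (U := 0) le_rfl hn0 hn2'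
  rcases le_or_gt s (3 / 5) with hp | hp
  · have hfl := objE_floor_between hn0 hn2' (by norm_num : (27 / 50 : ℝ) ≤ 3 / 5) ra rb hs1 hp
    exact doccN_lt_of_cap8_threshold (U₁ := 38 / 5) (by norm_num) (by norm_num) hU hn0 hn2' hcap hfl
      (sub_min_lt_of (by linarith) (by linarith))
  · have hfl := objE_floor_between hn0 hn2' (by norm_num : (3 / 5 : ℝ) ≤ 13 / 20) rb rc hp.le hs2
    exact doccN_lt_of_cap8_threshold (U₁ := 38 / 5) (by norm_num) (by norm_num) hU hn0 hn2' hcap hfl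
      (sub_min_lt_of (by linarith) (by linarith))

/-! ### §3 Saturated-FM words on the image faces -/

/-- **Sr₀.₉La₀.₁CuO₂ (M37), image face `s ∈ [27/50, 13/20]` × `m ∈ [0.89, 0.91]` — the SATURATED-FM class is excluded for EVERY `0 ≤ U ≤ 12`**
(⊇ the whole box `U/t_eff ∈ [2.42, 11.24]`): `e(1, s, U, n) < ½·e(1, s, 0, 2n)`. Cap = vacuum chord of the CERTIFIED #470 half-filling cap at `U = 12`;
floor = four-corner rows at `2n₀ = 9/5` (columns `27/50, 3/5, 13/20`); margin `+0.032`.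
[cite: LiebLoss1993, §8, Theorem 8.2] [cite: Tasaki1998, §2 Def. 2.1, §6 Thm. 6.1] [cite: Israel1979, Thm. I.3.4] -/
theorem slcoE_x010_lt_polarised_of (h470 : cert_r470_pb2_tl_upper_n1_U12)
    {s U n : ℝ} (hs1 : 27 / 50 ≤ s) (hs2 : s ≤ 13 / 20) (hU0 : 0 ≤ U) (hU : U ≤ 12)
    (hn1 : 89 / 100 ≤ n) (hn2 : n ≤ 91 / 100) :
    energyDensityTT' 1 s U n < 1 / 2 * energyDensityTT' 1 s 0 (2 * n) := by
  have hn0 : (0 : ℝ) ≤ n := by linarith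
  have hn2' : n < 2 := by linarith
  have hnpos : (0 : ℝ) < n := by linarith
  have h2n0 : (0 : ℝ) ≤ 2 * n := by linarith
  have h2n2 : 2 * n < 2 := by linarith
  have hcap := edop_half_cap (by norm_num : (0 : ℝ) ≤ 12) (edop_halfFilling_cap12 h470 s) hnpos (by linarith)
  have ra := fermiSeaRow4_tPrime_twentyseven_div_fifty_at_nine_div_five (U := 0) le_rfl h2n0 h2n2
  have rb := fermiSeaRow4_tPrime_three_div_five_at_nine_div_five (U := 0) le_rfl h2n0 h2n2
  have rc := fermiSeaRow4_tPrime_thirteen_div_twenty_at_nine_div_five (U := 0) le_rfl h2n0 h2n2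
  rcases le_or_gt s (3 / 5) with hp | hp
  · have hfl := objE_floor_between (s := s) h2n0 h2n2 (by norm_num : (27 / 50 : ℝ) ≤ 3 / 5) ra rb hs1 hp
    exact polar_word_of_cap hU0 hU hn0 hn2' hcap hfl (by linarith) (by linarith)
  · have hfl := objE_floor_between (s := s) h2n0 h2n2 (by norm_num : (3 / 5 : ℝ) ≤ 13 / 20) rb rc hp.le hs2
    exact polar_word_of_cap hU0 hU hn0 hn2' hcap hfl (by linarith) (by linarith)

/-- **Nd₁.₈₅Ce₀.₁₅CuO₄ (M20), image face `s ∈ [51/100, 31/50]` × `m ∈ [0.83, 0.91]` — saturated-FM class excluded for EVERY `0 ≤ U ≤ 6`** (⊇ the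
whole box `U/t_eff ∈ [2.4, 3.2]`): `e(1, s, U, n) < ½·e(1, s, 0, 2n)`. Cap = vacuum chord of the CERTIFIED #21 half-filling cap at `U = 6`; floor =
four-corner rows at `2n₀ = 9/5` (columns `49/100, 27/50, 3/5, 13/20`); margin `+0.10`.
[cite: LiebLoss1993, §8, Theorem 8.2] [cite: Tasaki1998, §2 Def. 2.1, §6 Thm. 6.1] [cite: Israel1979, Thm. I.3.4] -/
theorem nccoE_x015_lt_polarised_of (h21 : cert_r21_luc_tl_upper_n1_U6)
    {s U n : ℝ} (hs1 : 51 / 100 ≤ s) (hs2 : s ≤ 31 / 50) (hU0 : 0 ≤ U) (hU : U ≤ 6)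
    (hn1 : 83 / 100 ≤ n) (hn2 : n ≤ 91 / 100) :
    energyDensityTT' 1 s U n < 1 / 2 * energyDensityTT' 1 s 0 (2 * n) := by
  have hn0 : (0 : ℝ) ≤ n := by linarith
  have hn2' : n < 2 := by linarith
  have hnpos : (0 : ℝ) < n := by linarith
  have h2n0 : (0 : ℝ) ≤ 2 * n := by linarith
  have h2n2 : 2 * n < 2 := by linarith
  have hcap := edop_half_cap (by norm_num : (0 : ℝ) ≤ 6) (laLow_halfFilling_cap6 h21 s) hnpos (by linarith)
  have ra := fermiSeaRow4_tPrime_fortynine_div_hundred_at_nine_div_five (U := 0) le_rfl h2n0 h2n2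
  have rb := fermiSeaRow4_tPrime_twentyseven_div_fifty_at_nine_div_five (U := 0) le_rfl h2n0 h2n2
  have rc := fermiSeaRow4_tPrime_three_div_five_at_nine_div_five (U := 0) le_rfl h2n0 h2n2
  have rd := fermiSeaRow4_tPrime_thirteen_div_twenty_at_nine_div_five (U := 0) le_rfl h2n0 h2n2
  rcases le_or_gt s (27 / 50) with hp | hp
  · have hfl := objE_floor_between (s := s) h2n0 h2n2 (by norm_num : (49 / 100 : ℝ) ≤ 27 / 50) ra rb (by linarith) hp
    exact polar_word_of_cap hU0 hU hn0 hn2' hcap hfl (by linarith) (by linarith)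
  rcases le_or_gt s (3 / 5) with hq | hq
  · have hfl := objE_floor_between (s := s) h2n0 h2n2 (by norm_num : (27 / 50 : ℝ) ≤ 3 / 5) rb rc hp.le hq
    exact polar_word_of_cap hU0 hU hn0 hn2' hcap hfl (by linarith) (by linarith)
  · have hfl := objE_floor_between (s := s) h2n0 h2n2 (by norm_num : (3 / 5 : ℝ) ≤ 13 / 20) rc rd hq.le (by linarith)
    exact polar_word_of_cap hU0 hU hn0 hn2' hcap hfl (by linarith) (by linarith)

/-- **Nd₁.₉Ce₀.₁CuO₄ (M55), image face `s ∈ [499/1000, 613/1000]` × `m ∈ [0.88, 0.94]` — saturated-FM class excluded for EVERY `0 ≤ U ≤ 6`** (⊇ the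
whole box `U/t_eff ∈ [2.41, 3.20]`); cap #21 at `U = 6` (vacuum chord), floor = four-corner rows at `2n₀ = 9/5`; margin `+0.24`.
[cite: LiebLoss1993, §8, Theorem 8.2] [cite: Tasaki1998, §2 Def. 2.1, §6 Thm. 6.1] [cite: Israel1979, Thm. I.3.4] -/
theorem nccoE_x010_lt_polarised_of (h21 : cert_r21_luc_tl_upper_n1_U6)
    {s U n : ℝ} (hs1 : 499 / 1000 ≤ s) (hs2 : s ≤ 613 / 1000) (hU0 : 0 ≤ U) (hU : U ≤ 6)
    (hn1 : 22 / 25 ≤ n) (hn2 : n ≤ 47 / 50) :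
    energyDensityTT' 1 s U n < 1 / 2 * energyDensityTT' 1 s 0 (2 * n) := by
  have hn0 : (0 : ℝ) ≤ n := by linarith
  have hn2' : n < 2 := by linarith
  have hnpos : (0 : ℝ) < n := by linarith
  have h2n0 : (0 : ℝ) ≤ 2 * n := by linarith
  have h2n2 : 2 * n < 2 := by linarith
  have hcap := edop_half_cap (by norm_num : (0 : ℝ) ≤ 6) (laLow_halfFilling_cap6 h21 s) hnpos (by linarith)
  have ra := fermiSeaRow4_tPrime_fortynine_div_hundred_at_nine_div_five (U := 0) le_rfl h2n0 h2n2
  have rb := fermiSeaRow4_tPrime_twentyseven_div_fifty_at_nine_div_five (U := 0) le_rfl h2n0 h2n2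
  have rc := fermiSeaRow4_tPrime_three_div_five_at_nine_div_five (U := 0) le_rfl h2n0 h2n2
  have rd := fermiSeaRow4_tPrime_thirteen_div_twenty_at_nine_div_five (U := 0) le_rfl h2n0 h2n2
  rcases le_or_gt s (27 / 50) with hp | hp
  · have hfl := objE_floor_between (s := s) h2n0 h2n2 (by norm_num : (49 / 100 : ℝ) ≤ 27 / 50) ra rb (by linarith) hp
    exact polar_word_of_cap hU0 hU hn0 hn2' hcap hfl (by linarith) (by linarith)
  rcases le_or_gt s (3 / 5) with hq | hq
  · have hfl := objE_floor_between (s := s) h2n0 h2n2 (by norm_num : (27 / 50 : ℝ) ≤ 3 / 5) rb rc hp.le hq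
    exact polar_word_of_cap hU0 hU hn0 hn2' hcap hfl (by linarith) (by linarith)
  · have hfl := objE_floor_between (s := s) h2n0 h2n2 (by norm_num : (3 / 5 : ℝ) ≤ 13 / 20) rc rd hq.le (by linarith)
    exact polar_word_of_cap hU0 hU hn0 hn2' hcap hfl (by linarith) (by linarith)

/-- **Nd₂CuO₄ T′ parent (M56), electron half through its image: `s ∈ [23/50, 57/100]` × `m ∈ [0.99, 1)` — saturated-FM class excluded for EVERY
`0 ≤ U ≤ 16`** (⊇ the whole box `U/t_eff ∈ [2.17, 2.77]`); cap = vacuum chord of #469 at `U = 16`, floor = four-corner rows at `2n₀ = 199/100`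
(columns `23/50, 57/100`); margin `+0.22`. [cite: LiebLoss1993, §8, Theorem 8.2] [cite: Tasaki1998, §2 Def. 2.1, §6 Thm. 6.1] [cite: Israel1979, Thm. I.3.4] -/
theorem ncoE_parent_image_lt_polarised_of (h469 : cert_r469_pb2_tl_upper_n1_U16)
    {s U n : ℝ} (hs1 : 23 / 50 ≤ s) (hs2 : s ≤ 57 / 100) (hU0 : 0 ≤ U) (hU : U ≤ 16)
    (hn1 : 99 / 100 ≤ n) (hn2 : n < 1) :
    energyDensityTT' 1 s U n < 1 / 2 * energyDensityTT' 1 s 0 (2 * n) := by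
  have hn0 : (0 : ℝ) ≤ n := by linarith
  have hn2' : n < 2 := by linarith
  have hnpos : (0 : ℝ) < n := by linarith
  have h2n0 : (0 : ℝ) ≤ 2 * n := by linarith
  have h2n2 : 2 * n < 2 := by linarith
  have hcap := polar_half_cap16 (polar_halfFilling_cap16 h469 s) hnpos hn2
  have ra := fermiSeaRow4_tPrime_twentythree_div_fifty_at_hundredninetynine_div_hundred (U := 0) le_rfl h2n0 h2n2
  have rb := fermiSeaRow4_tPrime_fiftyseven_div_hundred_at_hundredninetynine_div_hundred (U := 0) le_rfl h2n0 h2n2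
  have hfl := objE_floor_between (s := s) h2n0 h2n2 (by norm_num : (23 / 50 : ℝ) ≤ 57 / 100) ra rb hs1 hs2
  exact polar_word_of_cap hU0 hU hn0 hn2' hcap hfl (by linarith) (by linarith)

/-- **Nd₂CuO₄ T′ parent (M56), hole half directly: `t′ ∈ [−57/100, −23/50]` × `n ∈ [0.99, 1)` — saturated-FM class excluded for EVERY
`0 ≤ U ≤ 16`**; cap #469 (vacuum chord), floor = four-corner rows at `2n₀ = 199/100` (columns `−57/100, −23/50`); margin `+0.18`.
[cite: LiebLoss1993, §8, Theorem 8.2] [cite: Tasaki1998, §2 Def. 2.1, §6 Thm. 6.1] [cite: Israel1979, Thm. I.3.4] -/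
theorem ncoE_parent_lt_polarised_of (h469 : cert_r469_pb2_tl_upper_n1_U16)
    {t' U n : ℝ} (ht1 : -57 / 100 ≤ t') (ht2 : t' ≤ -23 / 50) (hU0 : 0 ≤ U) (hU : U ≤ 16)
    (hn1 : 99 / 100 ≤ n) (hn2 : n < 1) :
    energyDensityTT' 1 t' U n < 1 / 2 * energyDensityTT' 1 t' 0 (2 * n) := by
  have hn0 : (0 : ℝ) ≤ n := by linarith
  have hn2' : n < 2 := by linarith
  have hnpos : (0 : ℝ) < n := by linarith
  have h2n0 : (0 : ℝ) ≤ 2 * n := by linarith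
  have h2n2 : 2 * n < 2 := by linarith
  have hcap := polar_half_cap16 (polar_halfFilling_cap16 h469 t') hnpos hn2
  have ra := fermiSeaRow4_tPrime_neg_fiftyseven_div_hundred_at_hundredninetynine_div_hundred (U := 0) le_rfl h2n0 h2n2
  have rb := fermiSeaRow4_tPrime_neg_twentythree_div_fifty_at_hundredninetynine_div_hundred (U := 0) le_rfl h2n0 h2n2
  have hfl := objE_floor_between (s := t') h2n0 h2n2 (by norm_num : (-57 / 100 : ℝ) ≤ -23 / 50) ra rb ht1 ht2
  exact polar_word_of_cap hU0 hU hn0 hn2' hcap hfl (by linarith) (by linarith)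

/-! ### §4 U-extensions after the S1 box widening of the T′ columns (appended 2026-08-27 by hubbard-tc-mod-3 g5)

`BOXES/Nd2CuO4-NCCO.md` 07:08:40Z moved the object-E `U/t_eff` hulls OUTWARD: M20 `[2.4, 8.23]`, M55 `[2.41, 8.37]`, M56 `[2.17, 7.24]`
(lead RULING R25 ADDENDUM 3). The `U ≤ 6` words of §3 no longer cover the M20/M55 boxes; M56 (`U ≤ 16`) is unaffected. Below: M55 to
`U ≤ 10` ⊇ the whole new box (CERTIFIED #471 half-filling cap `polarU_halfFilling_cap10` of `PolarisedClassExclusionLaU10`; exact margin `+0.0619`); M20 to `U ≤ 8` (CERTIFIED #472; right floor column AT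
the face edge `s = 31/50`, `HubbardFermiSeaFourCornerRowsB`; exact margin `+0.0185`) — covers `[2.4, 8]` of `[2.4, 8.23]`: at the corner
`(s, m) = (0.62, 0.83)` the saturated-FM floor and the vacuum-chord cap CROSS between `U = 8` and `U = 10` even with the exact Fermi sea
(float `−0.013` at `U₂ = 10`), so the sliver `(8, 8.23]` stays «undetermined-FM» with these devices (a direct cap at `(U, n) ≈ (9, 0.85)`,
`t′ ≈ +0.6` — or the n-tangent of a certified row there — would be needed). -/

/-- **Nd₁.₉Ce₀.₁CuO₄ (M55), image face `s ∈ [499/1000, 613/1000]` × `m ∈ [0.88, 0.94]` — saturated-FM class excluded for EVERY `0 ≤ U ≤ 10`**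
(⊇ the WIDENED box `U/t_eff ∈ [2.41, 8.37]`); cap = vacuum chord of the CERTIFIED #471 half-filling cap at `U = 10`, floor = four-corner rows at
`2n₀ = 9/5` (columns `49/100, 27/50, 3/5, 13/20`); exact margin `+0.0619`. [cite: LiebLoss1993, §8, Theorem 8.2] [cite: Tasaki1998, §2 Def. 2.1, §6 Thm. 6.1] [cite: Israel1979, Thm. I.3.4] -/
theorem nccoE_x010_lt_polarised_U10_of (h471 : cert_r471_pb2_tl_upper_n1_U10)
    {s U n : ℝ} (hs1 : 499 / 1000 ≤ s) (hs2 : s ≤ 613 / 1000) (hU0 : 0 ≤ U) (hU : U ≤ 10)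
    (hn1 : 22 / 25 ≤ n) (hn2 : n ≤ 47 / 50) :
    energyDensityTT' 1 s U n < 1 / 2 * energyDensityTT' 1 s 0 (2 * n) := by
  have hn0 : (0 : ℝ) ≤ n := by linarith
  have hn2' : n < 2 := by linarith
  have hnpos : (0 : ℝ) < n := by linarith
  have h2n0 : (0 : ℝ) ≤ 2 * n := by linarith
  have h2n2 : 2 * n < 2 := by linarith
  have hcap := edop_half_cap (by norm_num : (0 : ℝ) ≤ 10) (polarU_halfFilling_cap10 h471 s) hnpos (by linarith)
  have ra := fermiSeaRow4_tPrime_fortynine_div_hundred_at_nine_div_five (U := 0) le_rfl h2n0 h2n2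
  have rb := fermiSeaRow4_tPrime_twentyseven_div_fifty_at_nine_div_five (U := 0) le_rfl h2n0 h2n2
  have rc := fermiSeaRow4_tPrime_three_div_five_at_nine_div_five (U := 0) le_rfl h2n0 h2n2
  have rd := fermiSeaRow4_tPrime_thirteen_div_twenty_at_nine_div_five (U := 0) le_rfl h2n0 h2n2
  rcases le_or_gt s (27 / 50) with hp | hp
  · have hfl := objE_floor_between (s := s) h2n0 h2n2 (by norm_num : (49 / 100 : ℝ) ≤ 27 / 50) ra rb (by linarith) hp
    exact polar_word_of_cap hU0 hU hn0 hn2' hcap hfl (by linarith) (by linarith)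
  rcases le_or_gt s (3 / 5) with hq | hq
  · have hfl := objE_floor_between (s := s) h2n0 h2n2 (by norm_num : (27 / 50 : ℝ) ≤ 3 / 5) rb rc hp.le hq
    exact polar_word_of_cap hU0 hU hn0 hn2' hcap hfl (by linarith) (by linarith)
  · have hfl := objE_floor_between (s := s) h2n0 h2n2 (by norm_num : (3 / 5 : ℝ) ≤ 13 / 20) rc rd hq.le (by linarith)
    exact polar_word_of_cap hU0 hU hn0 hn2' hcap hfl (by linarith) (by linarith)

/-- **Nd₁.₈₅Ce₀.₁₅CuO₄ (M20), image face `s ∈ [51/100, 31/50]` × `m ∈ [0.83, 0.91]` — saturated-FM class excluded for EVERY `0 ≤ U ≤ 8`**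
(covers `[2.4, 8]` of the widened box `[2.4, 8.23]`; see the §4 header for the sliver); cap = vacuum chord of the CERTIFIED #472 half-filling cap at
`U = 8`, floor = four-corner rows at `2n₀ = 9/5` with the right column AT `s = 31/50` (columns `49/100, 27/50, 3/5, 31/50`); exact margin `+0.0185`.
[cite: LiebLoss1993, §8, Theorem 8.2] [cite: Tasaki1998, §2 Def. 2.1, §6 Thm. 6.1] [cite: Israel1979, Thm. I.3.4] -/
theorem nccoE_x015_lt_polarised_U8_of (h472 : cert_r472_pb2_tl_upper_n1_U8)
    {s U n : ℝ} (hs1 : 51 / 100 ≤ s) (hs2 : s ≤ 31 / 50) (hU0 : 0 ≤ U) (hU : U ≤ 8)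
    (hn1 : 83 / 100 ≤ n) (hn2 : n ≤ 91 / 100) :
    energyDensityTT' 1 s U n < 1 / 2 * energyDensityTT' 1 s 0 (2 * n) := by
  have hn0 : (0 : ℝ) ≤ n := by linarith
  have hn2' : n < 2 := by linarith
  have hnpos : (0 : ℝ) < n := by linarith
  have h2n0 : (0 : ℝ) ≤ 2 * n := by linarith
  have h2n2 : 2 * n < 2 := by linarith
  have hcap := objE_half_cap8 (objE_halfFilling_cap8 h472 s) hnpos (by linarith)
  have ra := fermiSeaRow4_tPrime_fortynine_div_hundred_at_nine_div_five (U := 0) le_rfl h2n0 h2n2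
  have rb := fermiSeaRow4_tPrime_twentyseven_div_fifty_at_nine_div_five (U := 0) le_rfl h2n0 h2n2
  have rc := fermiSeaRow4_tPrime_three_div_five_at_nine_div_five (U := 0) le_rfl h2n0 h2n2
  have rd := fermiSeaRow4_tPrime_thirtyone_div_fifty_at_nine_div_five (U := 0) le_rfl h2n0 h2n2
  rcases le_or_gt s (27 / 50) with hp | hp
  · have hfl := objE_floor_between (s := s) h2n0 h2n2 (by norm_num : (49 / 100 : ℝ) ≤ 27 / 50) ra rb (by linarith) hp
    exact polar_word_of_cap hU0 hU hn0 hn2' hcap hfl (by linarith) (by linarith)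
  rcases le_or_gt s (3 / 5) with hq | hq
  · have hfl := objE_floor_between (s := s) h2n0 h2n2 (by norm_num : (27 / 50 : ℝ) ≤ 3 / 5) rb rc hp.le hq
    exact polar_word_of_cap hU0 hU hn0 hn2' hcap hfl (by linarith) (by linarith)
  · have hfl := objE_floor_between (s := s) h2n0 h2n2 (by norm_num : (3 / 5 : ℝ) ≤ 31 / 50) rc rd hq.le hs2
    exact polar_word_of_cap hU0 hU hn0 hn2' hcap hfl (by linarith) (by linarith)

end Summit.Ventures.CertifiedManyBodySolver.Observables

end
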